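import Literature.NumberTheory.DiophantineGeometry.PastenSubexpApproximation
import HarnessLib

/-!
# Pasten's subexponential abc bounds, IV: the bound `Θ ≤ K · B^{10}` and the abc glue

Topic `NumberTheory/DiophantineGeometry`; namespace `Literature.NumberTheory.DiophantineGeometry.Pasten`.

Pasten, Invent. Math. 236 (2024), §4 [cite: Pasten2024, §4]: with the threshold `N = ⌊B⌋`,
`B = exp √((log R) log₂ R)`, the Shimura-curve input `∏_{p ∣ abc} ν_p(abc) ≤ κ R³`
(Theorem 2.5 with `ε = 1/3`) bounds the number `t = #I` of big primes through `B^t ≤ κ R³`,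
whence `K^{t+1} · max(1, h(ξ₀)) · ∏_{p ∈ I} log p ≤ K · B^{10}` for `log R ≥ L⋆`
(`theta_le_of_exponentProduct_le`; the source uses the AM–GM inequality and Lemma 3.1 at this
point, which improves only the constant in the exponent). The second part specialises the
approximation bound to an abc triple `a + b = c`: at the archimedean place with `ξ = b/c`
(`1 − ξ = a/c`, `arch_bound`), at a prime `p₀ ∣ a` with the same `ξ` (`ord_{p₀}(1 − ξ) = ν_{p₀}(a)`,
`padic_bound_a`) and at a prime `p₀ ∣ c` with `ξ = −a/b` (`1 − ξ = c/b`, `padic_bound_c`), and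
records `log x ≤ ν_{p₀}(x) · log rad(x)` for a prime `p₀` of maximal exponent
(`log_le_factorization_mul_log_radical`).

## References

* [Pasten2024] H. Pasten, Invent. Math. 236 (2024), 373–385, doi:10.1007/s00222-024-01244-6,
  arXiv:2312.03566 — §4, §5.
-/

noncomputable section

open Finset Real Height
open Literature.NumberTheory.DiophantineGeometry.Dioph

namespace Literature.NumberTheory.DiophantineGeometry.Pasten

/-! ### `Θ ≤ K · B^{10}` -/

/-- **The count of big primes.** With `R = rad(uvw)`, `L = log R ≥ L⋆`, `N = ⌊B(R)⌋` and
`∏_{p ∣ uvw} ν_p(uvw) ≤ κ R³`: `Θ = theta K u v N ≤ K · B^{10}`. [cite: Pasten2024, §4] -/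
theorem theta_le_of_exponentProduct_le {K κ : ℝ} (hK : 1 ≤ K) (hκ : 1 ≤ κ) {u v w : ℕ}
    (hu : u ≠ 0) (hv : v ≠ 0) (hw : w ≠ 0) (huv : u.Coprime v) (hcop : (u * v).Coprime w)
    (hL : Lstar K κ ≤ Real.log (UniqueFactorizationMonoid.radical (u * v * w) : ℕ))
    (hE : (exponentProduct (u * v * w) : ℝ) ≤
      κ * ((UniqueFactorizationMonoid.radical (u * v * w) : ℕ) : ℝ) ^ 3) :
    theta K u v ⌊bfun (UniqueFactorizationMonoid.radical (u * v * w) : ℕ)⌋₊ ≤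
      K * bfun (UniqueFactorizationMonoid.radical (u * v * w) : ℕ) ^ 10 := by
  set R : ℝ := ((UniqueFactorizationMonoid.radical (u * v * w) : ℕ) : ℝ) with hR
  set L : ℝ := Real.log R with hLdef
  set s : ℝ := Real.sqrt (L * Real.log L) with hs
  have hB : bfun R = Real.exp s := rfl
  set N : ℕ := ⌊bfun R⌋₊ with hN
  set t : ℕ := (bigPrimes u v N).card with ht
  have hR0 : 0 < R := by rw [hR]; exact_mod_cast Nat.radical_pos _
  have hL1 : 1 ≤ L := one_le_of_Lstar_le hL
  have hs0 : 0 < s := sqrt_mul_log_pos_of_Lstar_le hL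
  have hK0 : 0 ≤ K := zero_le_one.trans hK
  -- Step 1: `B^t ≤ κ R³`, hence `t · s ≤ log κ + 3L ≤ 4L`.
  have h1 : (N + 1) ^ t ≤ exponentProduct (u * v * w) :=
    pow_card_bigPrimes_le_exponentProduct hu hv huv hw hcop N
  have hBN : Real.exp s ≤ (N : ℝ) + 1 := by
    have := Nat.lt_floor_add_one (bfun R)
    rw [hB] at this
    exact this.le
  have h1' : Real.exp s ^ t ≤ κ * R ^ 3 := by
    calc Real.exp s ^ t ≤ ((N : ℝ) + 1) ^ t := pow_le_pow_left₀ (Real.exp_pos s).le hBN t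
      _ = (((N + 1) ^ t : ℕ) : ℝ) := by push_cast; ring
      _ ≤ exponentProduct (u * v * w) := by exact_mod_cast h1
      _ ≤ κ * R ^ 3 := hE
  have hts : t * s ≤ 4 * L := by
    have hκ0 : 0 < κ := lt_of_lt_of_le one_pos hκ
    have hlog := Real.log_le_log (pow_pos (Real.exp_pos s) t) h1'
    rw [← Real.exp_nat_mul, Real.log_exp, Real.log_mul hκ0.ne' (pow_pos hR0 3).ne',
      Real.log_pow] at hlog
    push_cast at hlog
    have hlogκ : Real.log κ ≤ L := le_of_max_le_right hL
    linarith
  -- Step 2: `Θ ≤ K^{t+1} · max(1, N·L) · L^t` and the elementary bounds.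
  have h2 : theta K u v N ≤ K ^ (t + 1) * (max 1 (N * L) * L ^ t) := theta_le hK hu hv hw N
  have hKL : (K * L) ^ t ≤ Real.exp (8 * s) := mul_pow_le_exp_of_Lstar_le hK hL hts
  have hLB : L ≤ Real.exp s := le_exp_sqrt_mul_log_of_Lstar_le hL
  have hNB : (N : ℝ) ≤ Real.exp s := by
    rw [hN, hB]; exact Nat.floor_le (Real.exp_pos s).le
  have hB1 : 1 ≤ Real.exp s := by linarith
  have hmax : max 1 ((N : ℝ) * L) ≤ Real.exp s * Real.exp s :=
    max_le (by nlinarith) (mul_le_mul hNB hLB (by linarith) (Real.exp_pos s).le)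
  have hprod : Real.exp s * Real.exp s * Real.exp (8 * s) = Real.exp s ^ 10 := by
    rw [← Real.exp_add, ← Real.exp_add, ← Real.exp_nat_mul]
    congr 1; push_cast; ring
  calc theta K u v N ≤ K ^ (t + 1) * (max 1 (N * L) * L ^ t) := h2
    _ = K * max 1 (N * L) * (K * L) ^ t := by rw [mul_pow]; ring
    _ ≤ K * (Real.exp s * Real.exp s) * Real.exp (8 * s) := by
        apply mul_le_mul (mul_le_mul_of_nonneg_left hmax hK0) hKL (by positivity) (by positivity)
    _ = K * Real.exp s ^ 10 := by rw [← hprod]; ring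

/-! ### abc triples: notation and coprimality -/

section triple

variable {a b c : ℕ}

/-- For an abc triple, `b` and `c` are coprime. [folklore] -/
theorem coprime_right_of_isABCTriple (h : IsABCTriple a b c) : b.Coprime c := by
  obtain ⟨-, -, rfl, hcop⟩ := h
  exact Nat.coprime_add_self_right.mpr hcop.symm

/-- For an abc triple, `a` and `c` are coprime. [folklore] -/
theorem coprime_left_of_isABCTriple (h : IsABCTriple a b c) : a.Coprime c := by
  obtain ⟨-, -, rfl, hcop⟩ := h
  exact Nat.coprime_self_add_right.mpr hcop

/-- `Θ_{b,c} ≤ K · B^{10}` for an abc triple (`ξ = b/c`, third member `a`).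
[cite: Pasten2024, §4] -/
theorem theta_bc_le {K κ : ℝ} (hK : 1 ≤ K) (hκ : 1 ≤ κ) (h : IsABCTriple a b c)
    (hL : Lstar K κ ≤ Real.log (rad a b c : ℕ))
    (hE : (exponentProduct (a * b * c) : ℝ) ≤ κ * (rad a b c : ℝ) ^ 3) :
    theta K b c ⌊bfun (rad a b c : ℕ)⌋₊ ≤ K * bfun (rad a b c : ℕ) ^ 10 := by
  obtain ⟨ha, hb, habc, hcop⟩ := h
  have hc : c ≠ 0 := by omega
  have hbc : b.Coprime c := coprime_right_of_isABCTriple ⟨ha, hb, habc, hcop⟩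
  have hac : a.Coprime c := coprime_left_of_isABCTriple ⟨ha, hb, habc, hcop⟩
  have hcop' : (b * c).Coprime a := Nat.Coprime.mul_left hcop.symm hac.symm
  have hrad : UniqueFactorizationMonoid.radical (b * c * a) = rad a b c := by
    rw [rad_def, show b * c * a = a * b * c by ring]
  have key := theta_le_of_exponentProduct_le hK hκ hb.ne' hc ha.ne' hbc hcop'
    (by rwa [hrad]) (by rwa [hrad, show b * c * a = a * b * c by ring])
  rwa [hrad] at key

/-- `Θ_{a,b} ≤ K · B^{10}` for an abc triple (`ξ = −a/b`, third member `c`).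
[cite: Pasten2024, §5] -/
theorem theta_ab_le {K κ : ℝ} (hK : 1 ≤ K) (hκ : 1 ≤ κ) (h : IsABCTriple a b c)
    (hL : Lstar K κ ≤ Real.log (rad a b c : ℕ))
    (hE : (exponentProduct (a * b * c) : ℝ) ≤ κ * (rad a b c : ℝ) ^ 3) :
    theta K a b ⌊bfun (rad a b c : ℕ)⌋₊ ≤ K * bfun (rad a b c : ℕ) ^ 10 := by
  obtain ⟨ha, hb, habc, hcop⟩ := h
  have hc : c ≠ 0 := by omega
  have hbc : b.Coprime c := coprime_right_of_isABCTriple ⟨ha, hb, habc, hcop⟩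
  have hac : a.Coprime c := coprime_left_of_isABCTriple ⟨ha, hb, habc, hcop⟩
  have hcop' : (a * b).Coprime c := Nat.Coprime.mul_left hac hbc
  have key := theta_le_of_exponentProduct_le hK hκ ha.ne' hb.ne' hc hcop hcop'
    (by rwa [← rad_def]) (by rwa [← rad_def])
  rwa [← rad_def] at key

/-! ### The three applications of the approximation bound -/

/-- **Archimedean place, `ξ = b/c`:** `log c − log a < Θ_{b,c} · log max{e, 2 log c}`
(`1 − ξ = a/c`, `h(b/c) ≤ log b + log c ≤ 2 log c`). [cite: Pasten2024, §4] -/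
theorem arch_bound {K : ℝ} (hK : 1 ≤ K) (hP : PastenApproximationBound K) (h : IsABCTriple a b c)
    (N : ℕ) :
    Real.log c - Real.log a < theta K b c N * Real.log (max (Real.exp 1) (2 * Real.log c)) := by
  obtain ⟨ha, hb, habc, hcop⟩ := h
  have hc : 0 < c := by omega
  have hbc : b.Coprime c := coprime_right_of_isABCTriple ⟨ha, hb, habc, hcop⟩
  have h1 : 1 < b * c := by nlinarith
  have hc' : (c : ℚ) ≠ 0 := by exact_mod_cast hc.ne'
  have hξ1 : (1 : ℚ) * ((b : ℚ) / c) ≠ 1 := by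
    rw [one_mul, Ne, div_eq_one_iff_eq hc']
    exact_mod_cast (show b ≠ c by omega)
  obtain ⟨hA, -⟩ := approx_div hK hP hb.ne' hc.ne' hbc h1 N (Or.inl rfl) hξ1
  have hsub : (1 : ℚ) - 1 * ((b : ℚ) / c) = (a : ℚ) / c := by
    rw [one_mul, eq_div_iff hc', sub_mul, div_mul_cancel₀ _ hc', one_mul]
    exact_mod_cast (show (c : ℤ) - b = a by omega)
  rw [hsub] at hA
  have hcast : ((((a : ℚ) / c : ℚ)) : ℝ) = (a : ℝ) / c := by push_cast; rfl
  have ha' : (0 : ℝ) < a := by exact_mod_cast ha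
  have hc'' : (0 : ℝ) < c := by exact_mod_cast hc
  rw [hcast, abs_of_pos (div_pos ha' hc''), Real.log_div ha'.ne' hc''.ne'] at hA
  have hh : logHeight₁ (1 * ((b : ℚ) / c)) ≤ 2 * Real.log c := by
    refine (logHeight₁_sign_mul_div_le hb.ne' hc.ne' (Or.inl rfl)).trans ?_
    have : Real.log b ≤ Real.log c :=
      Real.log_le_log (by exact_mod_cast hb) (by exact_mod_cast (show b ≤ c by omega))
    linarith
  have hΘ := theta_nonneg (zero_le_one.trans hK) b c N
  calc Real.log c - Real.log a = -(Real.log a - Real.log c) := by ring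
    _ < theta K b c N * Real.log (max (Real.exp 1) (logHeight₁ (1 * ((b : ℚ) / c)))) := hA
    _ ≤ theta K b c N * Real.log (max (Real.exp 1) (2 * Real.log c)) :=
        mul_le_mul_of_nonneg_left (log_max_exp_mono hh) hΘ

/-- **A prime `p ∣ a`, `ξ = b/c`:** `ν_p(a) · log p < Θ_{b,c} · (p / log p) · (log p + log max{e, 2 log c})`
(`ord_p(1 − ξ) = ord_p(a/c) = ν_p(a)`). [cite: Pasten2024, §5] -/
theorem padic_bound_a {K : ℝ} (hK : 1 ≤ K) (hP : PastenApproximationBound K)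
    (h : IsABCTriple a b c) (N : ℕ) {p : ℕ} (hp : p.Prime) (hpa : p ∣ a) :
    (a.factorization p : ℝ) * Real.log p < theta K b c N *
      ((p / Real.log p) * (Real.log p + Real.log (max (Real.exp 1) (2 * Real.log c)))) := by
  obtain ⟨ha, hb, habc, hcop⟩ := h
  have hc : 0 < c := by omega
  have hbc : b.Coprime c := coprime_right_of_isABCTriple ⟨ha, hb, habc, hcop⟩
  have hac : a.Coprime c := coprime_left_of_isABCTriple ⟨ha, hb, habc, hcop⟩
  have h1 : 1 < b * c := by nlinarith
  have hc' : (c : ℚ) ≠ 0 := by exact_mod_cast hc.ne'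
  have hξ1 : (1 : ℚ) * ((b : ℚ) / c) ≠ 1 := by
    rw [one_mul, Ne, div_eq_one_iff_eq hc']
    exact_mod_cast (show b ≠ c by omega)
  obtain ⟨-, hN⟩ := approx_div hK hP hb.ne' hc.ne' hbc h1 N (Or.inl rfl) hξ1
  have hNp := hN p hp
  have hsub : (1 : ℚ) - 1 * ((b : ℚ) / c) = (a : ℚ) / c := by
    rw [one_mul, eq_div_iff hc', sub_mul, div_mul_cancel₀ _ hc', one_mul]
    exact_mod_cast (show (c : ℤ) - b = a by omega)
  rw [hsub] at hNp
  have hpc : ¬p ∣ c := fun hpc =>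
    hp.one_lt.ne' (Nat.dvd_one.mp (hac.gcd_eq_one ▸ Nat.dvd_gcd hpa hpc))
  have hval : padicValRat p ((a : ℚ) / c) = a.factorization p := by
    haveI : Fact p.Prime := ⟨hp⟩
    rw [padicValRat.div (by exact_mod_cast ha.ne') hc', padicValRat.of_nat, padicValRat.of_nat,
      padicValNat.eq_zero_of_not_dvd hpc, Nat.factorization_def a hp]
    simp
  rw [hval] at hNp
  push_cast at hNp
  have hh : logHeight₁ (1 * ((b : ℚ) / c)) ≤ 2 * Real.log c := by
    refine (logHeight₁_sign_mul_div_le hb.ne' hc.ne' (Or.inl rfl)).trans ?_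
    have : Real.log b ≤ Real.log c :=
      Real.log_le_log (by exact_mod_cast hb) (by exact_mod_cast (show b ≤ c by omega))
    linarith
  have hΘ := theta_nonneg (zero_le_one.trans hK) b c N
  have hp1 : (1 : ℝ) ≤ p := by exact_mod_cast hp.one_lt.le
  have hpl : 0 ≤ (p : ℝ) / Real.log p :=
    div_nonneg (by linarith) (Real.log_nonneg hp1)
  refine hNp.trans_le (mul_le_mul_of_nonneg_left (mul_le_mul_of_nonneg_left ?_ hpl) hΘ)
  exact (log_max_exp_mul_le hp1).trans (by linarith [log_max_exp_mono (t₁ := logHeight₁ (1 * ((b : ℚ) / c))) hh])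

/-- **A prime `p ∣ c`, `ξ = −a/b`:** `ν_p(c) · log p < Θ_{a,b} · (p / log p) · (log p + log max{e, 2 log c})`
(`1 − ξ = c/b`, `ord_p(c/b) = ν_p(c)`; needs `ab > 1`, i.e. the triple is not `1 + 1 = 2`).
[cite: Pasten2024, §5] -/
theorem padic_bound_c {K : ℝ} (hK : 1 ≤ K) (hP : PastenApproximationBound K)
    (h : IsABCTriple a b c) (h1 : 1 < a * b) (N : ℕ) {p : ℕ} (hp : p.Prime) (hpc : p ∣ c) :
    (c.factorization p : ℝ) * Real.log p < theta K a b N *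
      ((p / Real.log p) * (Real.log p + Real.log (max (Real.exp 1) (2 * Real.log c)))) := by
  obtain ⟨ha, hb, habc, hcop⟩ := h
  have hc : 0 < c := by omega
  have hbc : b.Coprime c := coprime_right_of_isABCTriple ⟨ha, hb, habc, hcop⟩
  have hb' : (b : ℚ) ≠ 0 := by exact_mod_cast hb.ne'
  have hξ1 : (-1 : ℚ) * ((a : ℚ) / b) ≠ 1 := by
    intro h'
    have : (0 : ℚ) < (a : ℚ) / b := div_pos (by exact_mod_cast ha) (by exact_mod_cast hb)
    linarith
  obtain ⟨-, hN⟩ := approx_div hK hP ha.ne' hb.ne' hcop h1 N (Or.inr rfl) hξ1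
  have hNp := hN p hp
  have hsub : (1 : ℚ) - (-1) * ((a : ℚ) / b) = (c : ℚ) / b := by
    rw [neg_one_mul, sub_neg_eq_add, eq_div_iff hb', add_mul, div_mul_cancel₀ _ hb', one_mul]
    exact_mod_cast (show b + a = c by omega)
  rw [hsub] at hNp
  have hpb : ¬p ∣ b := fun hpb =>
    hp.one_lt.ne' (Nat.dvd_one.mp (hbc.gcd_eq_one ▸ Nat.dvd_gcd hpb hpc))
  have hval : padicValRat p ((c : ℚ) / b) = c.factorization p := by
    haveI : Fact p.Prime := ⟨hp⟩
    rw [padicValRat.div (by exact_mod_cast hc.ne') hb', padicValRat.of_nat, padicValRat.of_nat,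
      padicValNat.eq_zero_of_not_dvd hpb, Nat.factorization_def c hp]
    simp
  rw [hval] at hNp
  push_cast at hNp
  have hh : logHeight₁ ((-1) * ((a : ℚ) / b)) ≤ 2 * Real.log c := by
    refine (logHeight₁_sign_mul_div_le ha.ne' hb.ne' (Or.inr rfl)).trans ?_
    have h₁ : Real.log a ≤ Real.log c :=
      Real.log_le_log (by exact_mod_cast ha) (by exact_mod_cast (show a ≤ c by omega))
    have h₂ : Real.log b ≤ Real.log c :=
      Real.log_le_log (by exact_mod_cast hb) (by exact_mod_cast (show b ≤ c by omega))
    linarith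
  have hΘ := theta_nonneg (zero_le_one.trans hK) a b N
  have hp1 : (1 : ℝ) ≤ p := by exact_mod_cast hp.one_lt.le
  have hpl : 0 ≤ (p : ℝ) / Real.log p :=
    div_nonneg (by linarith) (Real.log_nonneg hp1)
  refine hNp.trans_le (mul_le_mul_of_nonneg_left (mul_le_mul_of_nonneg_left ?_ hpl) hΘ)
  exact (log_max_exp_mul_le hp1).trans
    (by linarith [log_max_exp_mono (t₁ := logHeight₁ ((-1) * ((a : ℚ) / b))) hh])

end triple

/-! ### The member carrying a prime of maximal exponent -/

/-- If `p₀` carries the largest exponent in `x`, then `x ≤ rad(x)^{ν_{p₀}(x)}`, i.e.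
`log x ≤ ν_{p₀}(x) · log rad(x)`. [cite: Pasten2024, §5] -/
theorem log_le_factorization_mul_log_radical {x p₀ : ℕ} (hx : x ≠ 0)
    (hmax : ∀ p ∈ x.primeFactors, x.factorization p ≤ x.factorization p₀) :
    Real.log x ≤ x.factorization p₀ * Real.log (UniqueFactorizationMonoid.radical x : ℕ) := by
  have key : x ≤ UniqueFactorizationMonoid.radical x ^ x.factorization p₀ := by
    conv_lhs => rw [Nat.prod_primeFactors_pow_factorization hx]
    rw [Nat.radical_eq_prod_primeFactors, ← Finset.prod_pow]
    exact Finset.prod_le_prod (fun _ _ => Nat.zero_le _) fun p hp =>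
      Nat.pow_le_pow_right (Nat.pos_of_mem_primeFactors hp) (hmax p hp)
  calc Real.log x
      ≤ Real.log (((UniqueFactorizationMonoid.radical x : ℕ) : ℝ) ^ x.factorization p₀) := by
        apply Real.log_le_log (by exact_mod_cast Nat.pos_of_ne_zero hx)
        exact_mod_cast key
    _ = x.factorization p₀ * Real.log (UniqueFactorizationMonoid.radical x : ℕ) := by
        rw [Real.log_pow]

/-- `rad(x) ≤ rad(n)` for `x ∣ n ≠ 0` (as real numbers, through `log`).
[folklore] -/
theorem log_radical_le_of_dvd {x n : ℕ} (hxn : x ∣ n) (hn : n ≠ 0) :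
    Real.log (UniqueFactorizationMonoid.radical x : ℕ) ≤
      Real.log (UniqueFactorizationMonoid.radical n : ℕ) :=
by
  refine Real.log_le_log (by exact_mod_cast Nat.radical_pos x) ?_
  exact_mod_cast Nat.le_of_dvd (Nat.radical_pos n)
    (UniqueFactorizationMonoid.radical_dvd_radical hxn hn)

end Literature.NumberTheory.DiophantineGeometry.Pasten

end
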